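import Literature.Geometry.Symplectic.OrigamiForm
import Mathlib.LinearAlgebra.Determinant
import Mathlib.LinearAlgebra.Matrix.Determinant.Basic
import Mathlib.Topology.Algebra.Module.Alternating.Topology
import HarnessLib

/-!
# The Pfaffian of a 2-form on `ℝ⁴`: expansion, functoriality, degeneracy

Companion to `OrigamiForm.lean`, which introduces `pfaffian α` — the Pfaffian of a continuous
alternating 2-form `α` on `ℝ⁴` in the standard basis,
`Pf α = α(e₀,e₁) α(e₂,e₃) - α(e₀,e₂) α(e₁,e₃) + α(e₀,e₃) α(e₁,e₂)` — and uses its chart-wise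
vanishing / transversality to phrase folded symplectic forms.  This file supplies the linear
algebra behind the slogans "`det = Pf²`, so `α` is degenerate iff `Pf α = 0`" and
"`α ∧ α = 2 Pf(α) e⁰¹²³`, so `Pf` transforms with the determinant":

* `alt_two_apply_eq` — the six-term coordinate expansion of `α ![u, w]`;
* `pfaffian_compContinuousLinearMap` — `Pf (α ∘ (L × L)) = det L · Pf α`;
* `pfaffian_eq_zero_iff` — `Pf α = 0 ↔ ∃ v ≠ 0, ∀ w, α ![v, w] = 0` (via the identity
  `A · B = -Pf(A) · 1` for the Hodge-dual skew matrix `B`);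
* `continuous_pfaffian`.

All statements are elementary (folklore multilinear algebra in dimension four).
-/

noncomputable section

open scoped Manifold
open Set Function

namespace Literature.Geometry.Symplectic

/-! ### Coordinates and the bilinear expansion -/

/-- Coordinates of the standard basis vectors: `(eᵢ)ⱼ = δᵢⱼ`. [folklore] -/
@[simp] theorem stdVec_apply (i j : Fin 4) : stdVec i j = if j = i then 1 else 0 := by
  simp [stdVec]

/-- Every vector of `ℝ⁴` is the combination of the standard vectors with its coordinates.
[folklore] -/
theorem sum_smul_stdVec (v : EuclideanSpace ℝ (Fin 4)) : ∑ i, v i • stdVec i = v := by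
  have h := (EuclideanSpace.basisFun (Fin 4) ℝ).sum_repr v
  simpa [stdVec, EuclideanSpace.basisFun_apply] using h

/-- A 2-form is additive in its first argument. [folklore] -/
theorem alt_two_add_left (α : (EuclideanSpace ℝ (Fin 4)) [⋀^Fin 2]→L[ℝ] ℝ)
    (u u' w : EuclideanSpace ℝ (Fin 4)) :
    α ![u + u', w] = α ![u, w] + α ![u', w] :=
  α.vecCons_add ![w] u u'

/-- A 2-form is homogeneous in its first argument. [folklore] -/
theorem alt_two_smul_left (α : (EuclideanSpace ℝ (Fin 4)) [⋀^Fin 2]→L[ℝ] ℝ) (c : ℝ)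
    (u w : EuclideanSpace ℝ (Fin 4)) :
    α ![c • u, w] = c * α ![u, w] :=
  α.vecCons_smul ![w] c u

/-- A 2-form is antisymmetric. [folklore] -/
theorem alt_two_swap (α : (EuclideanSpace ℝ (Fin 4)) [⋀^Fin 2]→L[ℝ] ℝ)
    (u w : EuclideanSpace ℝ (Fin 4)) : α ![w, u] = -α ![u, w] := by
  have h := α.map_swap ![u, w] (i := 0) (j := 1) (by decide)
  have hsw : (![u, w] : Fin 2 → EuclideanSpace ℝ (Fin 4)) ∘ Equiv.swap (0 : Fin 2) 1 = ![w, u] := by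
    funext k
    fin_cases k <;> rfl
  rw [hsw] at h
  exact h

/-- A 2-form vanishes on a repeated vector. [folklore] -/
theorem alt_two_self (α : (EuclideanSpace ℝ (Fin 4)) [⋀^Fin 2]→L[ℝ] ℝ)
    (u : EuclideanSpace ℝ (Fin 4)) : α ![u, u] = 0 :=
  α.map_eq_zero_of_eq ![u, u] (i := 0) (j := 1) rfl (by decide)

/-- Expansion in the first argument: `α ![u, w] = ∑ᵢ uᵢ α ![eᵢ, w]` (linearity of
`u ↦ α ![u, w]`). [folklore] -/
theorem alt_two_sum_left (α : (EuclideanSpace ℝ (Fin 4)) [⋀^Fin 2]→L[ℝ] ℝ)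
    (u w : EuclideanSpace ℝ (Fin 4)) :
    α ![u, w] = ∑ i, u i * α ![stdVec i, w] := by
  let L : (EuclideanSpace ℝ (Fin 4)) →ₗ[ℝ] ℝ :=
    { toFun := fun u => α ![u, w]
      map_add' := fun u u' => alt_two_add_left α u u' w
      map_smul' := fun c u => alt_two_smul_left α c u w }
  have hL : ∀ u, α ![u, w] = L u := fun _ => rfl
  conv_lhs => rw [← sum_smul_stdVec u, hL, map_sum]
  refine Finset.sum_congr rfl fun i _ => ?_
  rw [map_smul, smul_eq_mul, ← hL]

/-- Double expansion: `α ![u, w] = ∑ᵢ ∑ⱼ uᵢ wⱼ α ![eᵢ, eⱼ]`. [folklore] -/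
theorem alt_two_sum (α : (EuclideanSpace ℝ (Fin 4)) [⋀^Fin 2]→L[ℝ] ℝ)
    (u w : EuclideanSpace ℝ (Fin 4)) :
    α ![u, w] = ∑ i, ∑ j, u i * w j * α ![stdVec i, stdVec j] := by
  rw [alt_two_sum_left]
  refine Finset.sum_congr rfl fun i _ => ?_
  rw [alt_two_swap, alt_two_sum_left, neg_eq_neg_one_mul, Finset.mul_sum, Finset.mul_sum]
  refine Finset.sum_congr rfl fun j _ => ?_
  rw [alt_two_swap α (stdVec i) (stdVec j)]
  ring

/-- **Six-term expansion** of a 2-form on `ℝ⁴` in the standard basis: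
`α(u, w) = ∑_{i<j} α(eᵢ, eⱼ) (uᵢ wⱼ - uⱼ wᵢ)`. [folklore] -/
theorem alt_two_apply_eq (α : (EuclideanSpace ℝ (Fin 4)) [⋀^Fin 2]→L[ℝ] ℝ)
    (u w : EuclideanSpace ℝ (Fin 4)) :
    α ![u, w] =
      α ![stdVec 0, stdVec 1] * (u 0 * w 1 - u 1 * w 0) +
      α ![stdVec 0, stdVec 2] * (u 0 * w 2 - u 2 * w 0) +
      α ![stdVec 0, stdVec 3] * (u 0 * w 3 - u 3 * w 0) +
      α ![stdVec 1, stdVec 2] * (u 1 * w 2 - u 2 * w 1) +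
      α ![stdVec 1, stdVec 3] * (u 1 * w 3 - u 3 * w 1) +
      α ![stdVec 2, stdVec 3] * (u 2 * w 3 - u 3 * w 2) := by
  rw [alt_two_sum]
  simp only [Fin.sum_univ_four]
  have h10 := alt_two_swap α (stdVec 0) (stdVec 1)
  have h20 := alt_two_swap α (stdVec 0) (stdVec 2)
  have h30 := alt_two_swap α (stdVec 0) (stdVec 3)
  have h21 := alt_two_swap α (stdVec 1) (stdVec 2)
  have h31 := alt_two_swap α (stdVec 1) (stdVec 3)
  have h32 := alt_two_swap α (stdVec 2) (stdVec 3)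
  rw [h10, h20, h30, h21, h31, h32, alt_two_self, alt_two_self, alt_two_self, alt_two_self]
  ring

/-! ### Functoriality: `Pf (α ∘ L) = det L · Pf α` -/

/-- Laplace expansion of a `4 × 4` determinant along the first row. [folklore] -/
theorem matrix_det_fin_four (A : Matrix (Fin 4) (Fin 4) ℝ) :
    A.det =
      A 0 0 * (A 1 1 * A 2 2 * A 3 3 - A 1 1 * A 2 3 * A 3 2 - A 1 2 * A 2 1 * A 3 3
        + A 1 2 * A 2 3 * A 3 1 + A 1 3 * A 2 1 * A 3 2 - A 1 3 * A 2 2 * A 3 1)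
      - A 0 1 * (A 1 0 * A 2 2 * A 3 3 - A 1 0 * A 2 3 * A 3 2 - A 1 2 * A 2 0 * A 3 3
        + A 1 2 * A 2 3 * A 3 0 + A 1 3 * A 2 0 * A 3 2 - A 1 3 * A 2 2 * A 3 0)
      + A 0 2 * (A 1 0 * A 2 1 * A 3 3 - A 1 0 * A 2 3 * A 3 1 - A 1 1 * A 2 0 * A 3 3
        + A 1 1 * A 2 3 * A 3 0 + A 1 3 * A 2 0 * A 3 1 - A 1 3 * A 2 1 * A 3 0)
      - A 0 3 * (A 1 0 * A 2 1 * A 3 2 - A 1 0 * A 2 2 * A 3 1 - A 1 1 * A 2 0 * A 3 2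
        + A 1 1 * A 2 2 * A 3 0 + A 1 2 * A 2 0 * A 3 1 - A 1 2 * A 2 1 * A 3 0) := by
  have s1 : Fin.succ (0 : Fin 3) = (1 : Fin 4) := by decide
  have s2 : Fin.succ (1 : Fin 3) = (2 : Fin 4) := by decide
  have s3 : Fin.succ (2 : Fin 3) = (3 : Fin 4) := by decide
  have a00 : (0 : Fin 4).succAbove (0 : Fin 3) = 1 := by decide
  have a01 : (0 : Fin 4).succAbove (1 : Fin 3) = 2 := by decide
  have a02 : (0 : Fin 4).succAbove (2 : Fin 3) = 3 := by decide
  have a10 : (1 : Fin 4).succAbove (0 : Fin 3) = 0 := by decide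
  have a11 : (1 : Fin 4).succAbove (1 : Fin 3) = 2 := by decide
  have a12 : (1 : Fin 4).succAbove (2 : Fin 3) = 3 := by decide
  have a20 : (2 : Fin 4).succAbove (0 : Fin 3) = 0 := by decide
  have a21 : (2 : Fin 4).succAbove (1 : Fin 3) = 1 := by decide
  have a22 : (2 : Fin 4).succAbove (2 : Fin 3) = 3 := by decide
  have a30 : (3 : Fin 4).succAbove (0 : Fin 3) = 0 := by decide
  have a31 : (3 : Fin 4).succAbove (1 : Fin 3) = 1 := by decide
  have a32 : (3 : Fin 4).succAbove (2 : Fin 3) = 2 := by decide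
  have v3 : ((3 : Fin 4) : ℕ) = 3 := rfl
  rw [Matrix.det_succ_row_zero, Fin.sum_univ_four]
  simp only [Matrix.det_fin_three, Matrix.submatrix_apply, s1, s2, s3, a00, a01, a02, a10, a11,
    a12, a20, a21, a22, a30, a31, a32, Fin.val_zero, Fin.val_one, Fin.val_two, v3, pow_zero,
    pow_one]
  ring

/-- The determinant of an endomorphism of `ℝ⁴` is the determinant of its matrix of coordinates
`(L eⱼ)ᵢ` in the standard basis. [folklore] -/
theorem linearMap_det_eq_det_coords
    (L : (EuclideanSpace ℝ (Fin 4)) →L[ℝ] EuclideanSpace ℝ (Fin 4)) :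
    LinearMap.det (L : (EuclideanSpace ℝ (Fin 4)) →ₗ[ℝ] EuclideanSpace ℝ (Fin 4)) =
      (Matrix.of fun i j => L (stdVec j) i).det := by
  rw [← LinearMap.det_toMatrix (EuclideanSpace.basisFun (Fin 4) ℝ).toBasis]
  congr 1

/-- **Functoriality of the Pfaffian**: pulling a 2-form back along a linear endomorphism `L` of
`ℝ⁴` multiplies its Pfaffian by `det L` (`(L^*α) ∧ (L^*α) = L^*(α ∧ α) = det L · α ∧ α`).
[folklore] -/
theorem pfaffian_compContinuousLinearMap (α : (EuclideanSpace ℝ (Fin 4)) [⋀^Fin 2]→L[ℝ] ℝ)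
    (L : (EuclideanSpace ℝ (Fin 4)) →L[ℝ] EuclideanSpace ℝ (Fin 4)) :
    pfaffian (α.compContinuousLinearMap L) =
      LinearMap.det (L : (EuclideanSpace ℝ (Fin 4)) →ₗ[ℝ] EuclideanSpace ℝ (Fin 4)) *
        pfaffian α := by
  rw [linearMap_det_eq_det_coords, matrix_det_fin_four]
  simp only [pfaffian, ContinuousAlternatingMap.compContinuousLinearMap_apply, Matrix.of_apply]
  have hc : ∀ a b : EuclideanSpace ℝ (Fin 4),
      (L : EuclideanSpace ℝ (Fin 4) → EuclideanSpace ℝ (Fin 4)) ∘ ![a, b] = ![L a, L b] :=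
      fun a b => by
    funext k
    fin_cases k <;> rfl
  simp only [hc]
  rw [alt_two_apply_eq α (L (stdVec 0)) (L (stdVec 1)),
    alt_two_apply_eq α (L (stdVec 2)) (L (stdVec 3)),
    alt_two_apply_eq α (L (stdVec 0)) (L (stdVec 2)),
    alt_two_apply_eq α (L (stdVec 1)) (L (stdVec 3)),
    alt_two_apply_eq α (L (stdVec 0)) (L (stdVec 3)),
    alt_two_apply_eq α (L (stdVec 1)) (L (stdVec 2))]
  ring

/-! ### Degeneracy: `Pf α = 0 ↔ ker α ≠ 0` -/

/-- If a non-zero vector lies in the kernel of `α`, then `Pf α = 0` (multiply the relations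
`∑ᵢ vᵢ α(eᵢ, eⱼ) = 0` by the Hodge-dual coefficients: `A · B = -Pf · 1`). [folklore] -/
theorem pfaffian_eq_zero_of_forall_eq_zero (α : (EuclideanSpace ℝ (Fin 4)) [⋀^Fin 2]→L[ℝ] ℝ)
    {v : EuclideanSpace ℝ (Fin 4)} (hv : v ≠ 0)
    (h : ∀ w, α ![v, w] = 0) : pfaffian α = 0 := by
  have h0 := h (stdVec 0)
  have h1 := h (stdVec 1)
  have h2 := h (stdVec 2)
  have h3 := h (stdVec 3)
  rw [alt_two_apply_eq] at h0 h1 h2 h3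
  simp only [stdVec_apply, Fin.isValue, Fin.reduceEq, if_true, if_false, mul_one, mul_zero,
    sub_zero, zero_sub] at h0 h1 h2 h3
  -- abbreviations for the six coefficients
  set a01 := α ![stdVec 0, stdVec 1]
  set a02 := α ![stdVec 0, stdVec 2]
  set a03 := α ![stdVec 0, stdVec 3]
  set a12 := α ![stdVec 1, stdVec 2]
  set a13 := α ![stdVec 1, stdVec 3]
  set a23 := α ![stdVec 2, stdVec 3]
  have hPf : pfaffian α = a01 * a23 - a02 * a13 + a03 * a12 := rfl
  -- `Pf · vₖ = 0` for every `k`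
  have k0 : pfaffian α * v 0 = 0 := by
    rw [hPf]; linear_combination a23 * h1 - a13 * h2 + a12 * h3
  have k1 : pfaffian α * v 1 = 0 := by
    rw [hPf]; linear_combination (-a23) * h0 + a03 * h2 - a02 * h3
  have k2 : pfaffian α * v 2 = 0 := by
    rw [hPf]; linear_combination a13 * h0 - a03 * h1 + a01 * h3
  have k3 : pfaffian α * v 3 = 0 := by
    rw [hPf]; linear_combination (-a12) * h0 + a02 * h1 - a01 * h2
  by_contra hne
  apply hv
  ext k
  fin_cases k
  · simpa [hne] using k0
  · simpa [hne] using k1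
  · simpa [hne] using k2
  · simpa [hne] using k3

/-- If `Pf α = 0`, then `α` has a non-zero kernel vector (a non-zero row of the Hodge-dual
matrix `B`, since `B · A = -Pf · 1 = 0`; if `B = 0` then `α = 0`). [folklore] -/
theorem exists_forall_eq_zero_of_pfaffian_eq_zero (α : (EuclideanSpace ℝ (Fin 4)) [⋀^Fin 2]→L[ℝ] ℝ)
    (hPf : pfaffian α = 0) : ∃ v : EuclideanSpace ℝ (Fin 4), v ≠ 0 ∧ ∀ w, α ![v, w] = 0 := by
  set a01 := α ![stdVec 0, stdVec 1] with ha01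
  set a02 := α ![stdVec 0, stdVec 2] with ha02
  set a03 := α ![stdVec 0, stdVec 3] with ha03
  set a12 := α ![stdVec 1, stdVec 2] with ha12
  set a13 := α ![stdVec 1, stdVec 3] with ha13
  set a23 := α ![stdVec 2, stdVec 3] with ha23
  have hPf' : a01 * a23 - a02 * a13 + a03 * a12 = 0 := hPf
  -- the value of `α` on a vector with prescribed coordinates
  have hval : ∀ (c0 c1 c2 c3 : ℝ) (w : EuclideanSpace ℝ (Fin 4)),
      α ![WithLp.toLp 2 ![c0, c1, c2, c3], w] =
        a01 * (c0 * w 1 - c1 * w 0) + a02 * (c0 * w 2 - c2 * w 0) +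
        a03 * (c0 * w 3 - c3 * w 0) + a12 * (c1 * w 2 - c2 * w 1) +
        a13 * (c1 * w 3 - c3 * w 1) + a23 * (c2 * w 3 - c3 * w 2) := by
    intro c0 c1 c2 c3 w
    rw [alt_two_apply_eq]
    simp [ha01, ha02, ha03, ha12, ha13, ha23]
  have hne_of : ∀ (c0 c1 c2 c3 : ℝ), (c0 ≠ 0 ∨ c1 ≠ 0 ∨ c2 ≠ 0 ∨ c3 ≠ 0) →
      (WithLp.toLp 2 ![c0, c1, c2, c3] : EuclideanSpace ℝ (Fin 4)) ≠ 0 := by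
    intro c0 c1 c2 c3 hc h0
    have e : ∀ k, (WithLp.toLp 2 ![c0, c1, c2, c3] : EuclideanSpace ℝ (Fin 4)) k = 0 := fun k => by
      rw [h0]; rfl
    have e0 := e 0; have e1 := e 1; have e2 := e 2; have e3 := e 3
    simp at e0 e1 e2 e3
    rcases hc with hc | hc | hc | hc <;> contradiction
  by_cases hall : a01 = 0 ∧ a02 = 0 ∧ a03 = 0 ∧ a12 = 0 ∧ a13 = 0 ∧ a23 = 0
  · obtain ⟨e01, e02, e03, e12, e13, e23⟩ := hall
    refine ⟨WithLp.toLp 2 ![1, 0, 0, 0], hne_of 1 0 0 0 (Or.inl one_ne_zero), fun w => ?_⟩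
    rw [hval, e01, e02, e03, e12, e13, e23]
    ring
  -- the rows of the dual matrix `B` are kernel vectors: row 0 = (0, a23, -a13, a12),
  -- row 1 = (-a23, 0, a03, -a02), row 2 = (a13, -a03, 0, a01), row 3 = (-a12, a02, -a01, 0)
  have r0 : ∀ w, α ![WithLp.toLp 2 ![0, a23, -a13, a12], w] = 0 := fun w => by
    rw [hval]; linear_combination (-(w 0)) * hPf'
  have r1 : ∀ w, α ![WithLp.toLp 2 ![-a23, 0, a03, -a02], w] = 0 := fun w => by
    rw [hval]; linear_combination (-(w 1)) * hPf'
  have r2 : ∀ w, α ![WithLp.toLp 2 ![a13, -a03, 0, a01], w] = 0 := fun w => by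
    rw [hval]; linear_combination (-(w 2)) * hPf'
  have r3 : ∀ w, α ![WithLp.toLp 2 ![-a12, a02, -a01, 0], w] = 0 := fun w => by
    rw [hval]; linear_combination (-(w 3)) * hPf'
  simp only [not_and_or] at hall
  rcases hall with h | h | h | h | h | h
  · exact ⟨WithLp.toLp 2 ![a13, -a03, 0, a01],
      hne_of a13 (-a03) 0 a01 (Or.inr (Or.inr (Or.inr h))), r2⟩
  · exact ⟨WithLp.toLp 2 ![-a23, 0, a03, -a02],
      hne_of (-a23) 0 a03 (-a02) (Or.inr (Or.inr (Or.inr (neg_ne_zero.2 h)))), r1⟩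
  · exact ⟨WithLp.toLp 2 ![-a23, 0, a03, -a02],
      hne_of (-a23) 0 a03 (-a02) (Or.inr (Or.inr (Or.inl h))), r1⟩
  · exact ⟨WithLp.toLp 2 ![0, a23, -a13, a12],
      hne_of 0 a23 (-a13) a12 (Or.inr (Or.inr (Or.inr h))), r0⟩
  · exact ⟨WithLp.toLp 2 ![a13, -a03, 0, a01],
      hne_of a13 (-a03) 0 a01 (Or.inl h), r2⟩
  · exact ⟨WithLp.toLp 2 ![0, a23, -a13, a12],
      hne_of 0 a23 (-a13) a12 (Or.inr (Or.inl h)), r0⟩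

/-- **Degeneracy criterion**: a 2-form on `ℝ⁴` has a non-zero kernel vector iff its Pfaffian
vanishes (`det α = (Pf α)²`). [folklore] -/
theorem pfaffian_eq_zero_iff (α : (EuclideanSpace ℝ (Fin 4)) [⋀^Fin 2]→L[ℝ] ℝ) :
    pfaffian α = 0 ↔ ∃ v : EuclideanSpace ℝ (Fin 4), v ≠ 0 ∧ ∀ w, α ![v, w] = 0 :=
  ⟨exists_forall_eq_zero_of_pfaffian_eq_zero α,
    fun ⟨_, hv, h⟩ => pfaffian_eq_zero_of_forall_eq_zero α hv h⟩

/-- Membership in the fold of a 2-form on a 4-manifold is the vanishing of the Pfaffian of its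
value (on the standard basis of the model tangent space). [folklore] -/
theorem mem_fold_iff_pfaffian_eq_zero {M : Type*} [TopologicalSpace M]
    [ChartedSpace (EuclideanSpace ℝ (Fin 4)) M]
    (s : Literature.Geometry.Kaehler.MForm (𝓡 4) M ℝ 2) (x : M) :
    x ∈ fold s ↔ pfaffian (s x) = 0 := by
  rw [mem_fold_iff, pfaffian_eq_zero_iff]
  exact Iff.rfl

/-! ### Continuity -/

/-- The Pfaffian is a continuous function of the form. [folklore] -/
theorem continuous_pfaffian :
    Continuous (pfaffian : ((EuclideanSpace ℝ (Fin 4)) [⋀^Fin 2]→L[ℝ] ℝ) → ℝ) := by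
  unfold pfaffian
  fun_prop

end Literature.Geometry.Symplectic

end
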